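import Literature.MathematicalPhysics.QuantumFieldTheory.Balaban1983to89.Beta.TreeSliceUnipotent

/-!
# `BalabanUV.Beta.CombSlicePairPolarization` — row D1 ∕ (C1), RULING R-D1-g56-1 (C-4): **TWO FOREST (COMB) SLICES, ONE POLARIZATION**

WHAT ([folklore] finite-dimensional algebra over the tree's one-loop model; literal-agnostic; no definition of the row's objects,
no `def … : Prop`, nothing cited beyond the locators inherited from the two parents):

* §1 `polarization_withSlice_forest_eq_forest` — for a background family `F B = (Δ(B), Q(B))` of δ-constrained Gaussian data
  (`Beta.OneLoop`), two slices `τ`, `P` and residual gauge directions `W`, IF `τ B * W B` and `P B * W B` are BOTH (reindexed)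
  forest matrices of rank-decreasing rooted forests with unimodular child-end blocks for every `B` (`Beta.TreeSliceUnipotent`
  §2–§3), THEN under the dictionary clauses of `Beta.GaugeFixing` — (c1) `Δ(B)·W(B) = 0` (two-sided), (c2) `Q(B)·W(B) = 0` — and
  nondegeneracy of the `τ`-sliced bordered matrix near `B = 0`, the two δ-gauge-fixed families have THE SAME polarization:
  `polarization (B ↦ withSlice (F B) (τ B)) = polarization (B ↦ withSlice (F B) (P B))`.  This is `GaugeFixing`'s II
  (`polarization_withSlice_eq_withSlice`) with its clause (c3) and BOTH admissibility clauses DISCHARGED by the forest structure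
  (both Faddeev–Popov logarithms are `log 1 = 0` at every background) — no `C²` hypothesis and no defect term, in contrast with
  the one-forest form II″ `TreeSliceUnipotent.polarization_withSlice_eq_add_of_forest`.  `torusBetaZero_withSlice_forest_eq_forest`:
  the same `β⁰_T` at every colour and every pair.
* §2 the comb forest of ONE block in an ARBITRARY AXIS ORDER `σ : Equiv.Perm (Fin d)`: `permVertex σ` (relabel the offset's
  coordinates), `combParentOrd σ` (= `TreeSliceUnipotent.combParent` conjugated by `permVertex σ`: lower by one the non-zero
  coordinate that comes FIRST in the order `σ`), `combRank_permVertex` (the `ℓ¹` rank is order-blind), `combParentOrd_rank_lt`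
  (rank-decreasing for every `σ`), `abs_det_forestMatrix_combOrd_eq_one`.
* §3 `polarization_comb_orientations_eq` ∕ `torusBetaZero_comb_orientations_eq` — §1 for two axis orders `σ₁`, `σ₂` of the comb
  forest on `CombVertex d L`: a complete one-loop functional on a comb slice over jets obeying (c1)(c2) has a polarization that
  does NOT depend on the comb's orientation.

WHY (R-D1-g56-1 (B-0)∕(C-3)∕(C-4), journal `HOME/CLAIMS.log` [AN2-G56-R1]): the evaluated (III′) literal's polarization IS
orientation-dependent (LITCOV: spread₆∕|mean| = 0.179) while its jets are S₄-covariant; by §3 that is a BY-VALUE violation of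
(c1) or (c2) (or nondegeneracy) by its assembled objects — the clause test `R-AN2-56-TC` (`ttrl/requests.jsonl` l.4200) reads
which; and (III″)'s acceptance gate AT-0 ((c1)(c2) by value) makes AT-2's orientation half a COROLLARY of this file.
WHAT THIS IS NOT: no statement about which concrete `τ`, `P`, `W`, `Δ`, `Q` model the literal (that is the row's CHECK ITEM, by
value: AT-0); nothing of Bałaban's asserted, valued or discharged; 0 estimates; 0∕4 row-D1 binders; RECORD (ROOT M‴) unchanged;
NOT (C1) complete, NOT D1, NEVER «G-an2-4 closed», NOT BetaPertH, NOT continuum, NOT Clay.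

HONEST DEPENDENCY (page 1, mandatory): continuum YM on T⁴ ⇐ BetaPertH ∧ nine spine estimates (0/9 proved); BetaPertH ⇐ (D1) ∧ (D4) ∧ CAP+tail;
G-an2-4 gates asym, D1 and NE2/3/4.  Row D1 ∕ (C1) OWNER an2, gen 56, 2026-08-25.  No existing file touched.
-/

namespace Summit.QuantumFields.BalabanUV.Beta.CombSlicePairPolarization

open Literature.MathematicalPhysics.QuantumFieldTheory.Balaban1983to89.Beta
open Literature.MathematicalPhysics.QuantumFieldTheory.Balaban1983to89.Beta.GaugeFixing
open Literature.MathematicalPhysics.QuantumFieldTheory.Balaban1983to89.Beta.TreeSliceUnipotent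
open Matrix

/-! ## §1. Two forest slices, one polarization (II with (c3) and both admissibilities discharged) -/

section TwoForests

variable {X₁ X₂ κ : Type*} [Fintype X₁] [DecidableEq X₁] [Fintype X₂] [DecidableEq X₂] [Fintype κ] [DecidableEq κ]
variable {ι : Type*} [Fintype ι] [DecidableEq ι] {n m r : ℕ}

/-- [folklore] **TWO FOREST SLICES, ONE POLARIZATION.**  `GaugeFixing.polarization_withSlice_eq_withSlice` (II) for two slices
`τ`, `P` whose products with the gauge directions are BOTH reindexed forest matrices of rank-decreasing rooted forests with
unimodular child ends at every background: clause (c3) holds with constant `0` (`TreeSliceUnipotent.log_abs_det_eq_zero_of_forest`) and both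
admissibility clauses hold (`TreeSliceUnipotent.isUnit_det_of_forest`), so only
(c1) (two-sided), (c2) and the nondegeneracy of the `τ`-sliced bordered matrix remain as hypotheses. -/
theorem polarization_withSlice_forest_eq_forest (F : Family ι n m)
    (τ P : (ι → ℝ) → Matrix (Fin r) (Fin n) ℝ) (W : (ι → ℝ) → Matrix (Fin n) (Fin r) ℝ)
    (e₁ : X₁ × κ ≃ Fin r) (parent₁ : X₁ → Option X₁) (rk₁ : X₁ → ℕ) (hrk₁ : ∀ x y, parent₁ x = some y → rk₁ y < rk₁ x)
    (C₁ A₁ : (ι → ℝ) → X₁ → Matrix κ κ ℝ) (hA₁ : ∀ B x, |(A₁ B x).det| = 1)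
    (hτW : ∀ B, τ B * W B = Matrix.reindex e₁ e₁ (forestMatrix parent₁ (C₁ B) (A₁ B)))
    (e₂ : X₂ × κ ≃ Fin r) (parent₂ : X₂ → Option X₂) (rk₂ : X₂ → ℕ) (hrk₂ : ∀ x y, parent₂ x = some y → rk₂ y < rk₂ x)
    (C₂ A₂ : (ι → ℝ) → X₂ → Matrix κ κ ℝ) (hA₂ : ∀ B x, |(A₂ B x).det| = 1)
    (hPW : ∀ B, P B * W B = Matrix.reindex e₂ e₂ (forestMatrix parent₂ (C₂ B) (A₂ B)))
    (h : ∀ᶠ B in nhds 0, (F B).Δ * W B = 0 ∧ (F B).Δᵀ * W B = 0 ∧ (F B).Q * W B = 0 ∧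
      (withSlice (F B) (τ B)).kkt.det ≠ 0) :
    polarization (fun B => withSlice (F B) (τ B)) = polarization (fun B => withSlice (F B) (P B)) := by
  refine polarization_withSlice_eq_withSlice F τ P W 0 ?_ ?_
  · filter_upwards [h] with B hB
    exact ⟨hB.1, hB.2.1, hB.2.2.1, isUnit_det_of_forest τ W e₁ parent₁ rk₁ hrk₁ C₁ A₁ hA₁ hτW B,
      isUnit_det_of_forest P W e₂ parent₂ rk₂ hrk₂ C₂ A₂ hA₂ hPW B, hB.2.2.2⟩
  · refine Filter.Eventually.of_forall fun B => ?_
    rw [log_abs_det_eq_zero_of_forest τ W e₁ parent₁ rk₁ hrk₁ C₁ A₁ hA₁ hτW B,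
      log_abs_det_eq_zero_of_forest P W e₂ parent₂ rk₂ hrk₂ C₂ A₂ hA₂ hPW B, sub_self]

/-- [folklore] The torus one-loop coefficient does not see which of two forest slices fixes the residual gauge. -/
theorem torusBetaZero_withSlice_forest_eq_forest {d s c : ℕ} [NeZero s] (F : Family (ExtIndex d s c) n m)
    (τ P : (ExtIndex d s c → ℝ) → Matrix (Fin r) (Fin n) ℝ) (W : (ExtIndex d s c → ℝ) → Matrix (Fin n) (Fin r) ℝ)
    (e₁ : X₁ × κ ≃ Fin r) (parent₁ : X₁ → Option X₁) (rk₁ : X₁ → ℕ) (hrk₁ : ∀ x y, parent₁ x = some y → rk₁ y < rk₁ x)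
    (C₁ A₁ : (ExtIndex d s c → ℝ) → X₁ → Matrix κ κ ℝ) (hA₁ : ∀ B x, |(A₁ B x).det| = 1)
    (hτW : ∀ B, τ B * W B = Matrix.reindex e₁ e₁ (forestMatrix parent₁ (C₁ B) (A₁ B)))
    (e₂ : X₂ × κ ≃ Fin r) (parent₂ : X₂ → Option X₂) (rk₂ : X₂ → ℕ) (hrk₂ : ∀ x y, parent₂ x = some y → rk₂ y < rk₂ x)
    (C₂ A₂ : (ExtIndex d s c → ℝ) → X₂ → Matrix κ κ ℝ) (hA₂ : ∀ B x, |(A₂ B x).det| = 1)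
    (hPW : ∀ B, P B * W B = Matrix.reindex e₂ e₂ (forestMatrix parent₂ (C₂ B) (A₂ B)))
    (h : ∀ᶠ B in nhds 0, (F B).Δ * W B = 0 ∧ (F B).Δᵀ * W B = 0 ∧ (F B).Q * W B = 0 ∧
      (withSlice (F B) (τ B)).kkt.det ≠ 0) (a₀ : Fin c) (μ ν : Fin d) :
    torusBetaZero (fun B => withSlice (F B) (τ B)) a₀ μ ν = torusBetaZero (fun B => withSlice (F B) (P B)) a₀ μ ν :=
  torusBetaZero_eq_of_polarization_eq _ _
    (polarization_withSlice_forest_eq_forest F τ P W e₁ parent₁ rk₁ hrk₁ C₁ A₁ hA₁ hτW e₂ parent₂ rk₂ hrk₂ C₂ A₂ hA₂ hPW h)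
    a₀ μ ν

end TwoForests

/-! ## §2. The comb forest of one block in an arbitrary axis order -/

section CombOrder

variable {d L : ℕ} [NeZero L]

/-- [folklore] Relabel the coordinates of a non-zero offset by an axis order `σ` (still non-zero). -/
def permVertex (σ : Equiv.Perm (Fin d)) (x : CombVertex d L) : CombVertex d L :=
  ⟨x.1 ∘ σ, fun h => x.2 (funext fun i => by
    have := congrFun h (σ.symm i)
    simpa using this)⟩

/-- [folklore] Coordinates of the relabelled offset. -/
@[simp] theorem permVertex_val (σ : Equiv.Perm (Fin d)) (x : CombVertex d L) : (permVertex σ x).1 = x.1 ∘ σ := rfl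

/-- [folklore] Relabelling by `σ⁻¹` undoes relabelling by `σ`. -/
theorem permVertex_symm_permVertex (σ : Equiv.Perm (Fin d)) (x : CombVertex d L) :
    permVertex σ.symm (permVertex σ x) = x := by
  apply Subtype.ext
  funext i
  simp [permVertex]

/-- [folklore] The `ℓ¹` rank of an offset is blind to the axis order. -/
theorem combRank_permVertex (σ : Equiv.Perm (Fin d)) (x : CombVertex d L) : combRank (permVertex σ x) = combRank x := by
  unfold combRank
  exact Equiv.sum_comp σ (fun i => (x.1 i : ℕ))

/-- [folklore] **THE COMB PARENT MAP IN THE AXIS ORDER `σ`**: `TreeSliceUnipotent.combParent` conjugated by `permVertex σ` — lower by one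
the non-zero coordinate of the offset that comes first in the order `σ(0), σ(1), …` (for `σ = 1` this is `combParent`: the
lowest-INDEX non-zero coordinate; the reversed order gives the reflected comb). -/
def combParentOrd (σ : Equiv.Perm (Fin d)) (x : CombVertex d L) : Option (CombVertex d L) :=
  (combParent (permVertex σ x)).map (permVertex σ.symm)

/-- [folklore] The trivial order gives Bałaban's comb parent map of `TreeSliceUnipotent` §9. -/
theorem combParentOrd_one (x : CombVertex d L) : combParentOrd (1 : Equiv.Perm (Fin d)) x = combParent x := by
  unfold combParentOrd
  have h1 : permVertex (1 : Equiv.Perm (Fin d)) x = x := Subtype.ext (funext fun i => rfl)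
  have h2 : (permVertex (1 : Equiv.Perm (Fin d)).symm : CombVertex d L → CombVertex d L) = id :=
    funext fun y => Subtype.ext (funext fun i => rfl)
  rw [h1, h2, Option.map_id, id]

/-- [folklore] **THE COMB FOREST IS RANK-DECREASING IN EVERY AXIS ORDER.** -/
theorem combParentOrd_rank_lt (σ : Equiv.Perm (Fin d)) (x y : CombVertex d L) (h : combParentOrd σ x = some y) :
    combRank y < combRank x := by
  unfold combParentOrd at h
  obtain ⟨z, hz, rfl⟩ := Option.map_eq_some_iff.mp h
  rw [combRank_permVertex, ← combRank_permVertex σ x]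
  exact combParent_rank_lt _ _ hz

variable {κ : Type*} [Fintype κ] [DecidableEq κ]

/-- [folklore] PER-BLOCK UNIPOTENCY OF THE COMB FOREST IN THE AXIS ORDER `σ`: arbitrary parent-end blocks, unimodular child-end blocks
⇒ `|det| = 1`. -/
theorem abs_det_forestMatrix_combOrd_eq_one (σ : Equiv.Perm (Fin d)) (C A : CombVertex d L → Matrix κ κ ℝ)
    (hA : ∀ x, |(A x).det| = 1) :
    |(forestMatrix (combParentOrd (d := d) (L := L) σ) C A).det| = 1 :=
  abs_det_forestMatrix_eq_one _ C A combRank (fun x y h => combParentOrd_rank_lt σ x y h) hA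

end CombOrder

/-! ## §3. Two comb orientations, one polarization -/

section CombPair

variable {d L : ℕ} [NeZero L] {κ : Type*} [Fintype κ] [DecidableEq κ]
variable {ι : Type*} [Fintype ι] [DecidableEq ι] {n m r : ℕ}

/-- [folklore] **TWO COMB ORIENTATIONS, ONE POLARIZATION.**  If the slice × directions products of two comb-tree δ-gauges of one
block, taken in the axis orders `σ₁` and `σ₂`, are the (reindexed) comb forest matrices in those orders with unimodular child ends
at every background, then under (c1) (two-sided), (c2) and nondegeneracy of the `σ₁`-sliced bordered matrix the two families have
the same polarization — the orientation of the comb is invisible to a complete one-loop functional. -/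
theorem polarization_comb_orientations_eq (σ₁ σ₂ : Equiv.Perm (Fin d)) (F : Family ι n m)
    (τ P : (ι → ℝ) → Matrix (Fin r) (Fin n) ℝ) (W : (ι → ℝ) → Matrix (Fin n) (Fin r) ℝ)
    (e₁ e₂ : CombVertex d L × κ ≃ Fin r)
    (C₁ A₁ C₂ A₂ : (ι → ℝ) → CombVertex d L → Matrix κ κ ℝ) (hA₁ : ∀ B x, |(A₁ B x).det| = 1)
    (hA₂ : ∀ B x, |(A₂ B x).det| = 1)
    (hτW : ∀ B, τ B * W B = Matrix.reindex e₁ e₁ (forestMatrix (combParentOrd σ₁) (C₁ B) (A₁ B)))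
    (hPW : ∀ B, P B * W B = Matrix.reindex e₂ e₂ (forestMatrix (combParentOrd σ₂) (C₂ B) (A₂ B)))
    (h : ∀ᶠ B in nhds 0, (F B).Δ * W B = 0 ∧ (F B).Δᵀ * W B = 0 ∧ (F B).Q * W B = 0 ∧
      (withSlice (F B) (τ B)).kkt.det ≠ 0) :
    polarization (fun B => withSlice (F B) (τ B)) = polarization (fun B => withSlice (F B) (P B)) :=
  polarization_withSlice_forest_eq_forest F τ P W e₁ (combParentOrd σ₁) combRank
    (fun x y hxy => combParentOrd_rank_lt σ₁ x y hxy) C₁ A₁ hA₁ hτW e₂ (combParentOrd σ₂) combRank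
    (fun x y hxy => combParentOrd_rank_lt σ₂ x y hxy) C₂ A₂ hA₂ hPW h

/-- [folklore] … and the same torus one-loop coefficient `β⁰_T` at every colour and pair: the comb's orientation is invisible. -/
theorem torusBetaZero_comb_orientations_eq {dT s c : ℕ} [NeZero s] (σ₁ σ₂ : Equiv.Perm (Fin d))
    (F : Family (ExtIndex dT s c) n m)
    (τ P : (ExtIndex dT s c → ℝ) → Matrix (Fin r) (Fin n) ℝ) (W : (ExtIndex dT s c → ℝ) → Matrix (Fin n) (Fin r) ℝ)
    (e₁ e₂ : CombVertex d L × κ ≃ Fin r)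
    (C₁ A₁ C₂ A₂ : (ExtIndex dT s c → ℝ) → CombVertex d L → Matrix κ κ ℝ) (hA₁ : ∀ B x, |(A₁ B x).det| = 1)
    (hA₂ : ∀ B x, |(A₂ B x).det| = 1)
    (hτW : ∀ B, τ B * W B = Matrix.reindex e₁ e₁ (forestMatrix (combParentOrd σ₁) (C₁ B) (A₁ B)))
    (hPW : ∀ B, P B * W B = Matrix.reindex e₂ e₂ (forestMatrix (combParentOrd σ₂) (C₂ B) (A₂ B)))
    (h : ∀ᶠ B in nhds 0, (F B).Δ * W B = 0 ∧ (F B).Δᵀ * W B = 0 ∧ (F B).Q * W B = 0 ∧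
      (withSlice (F B) (τ B)).kkt.det ≠ 0) (a₀ : Fin c) (μ ν : Fin dT) :
    torusBetaZero (fun B => withSlice (F B) (τ B)) a₀ μ ν = torusBetaZero (fun B => withSlice (F B) (P B)) a₀ μ ν :=
  torusBetaZero_eq_of_polarization_eq _ _
    (polarization_comb_orientations_eq σ₁ σ₂ F τ P W e₁ e₂ C₁ A₁ C₂ A₂ hA₁ hA₂ hτW hPW h) a₀ μ ν

end CombPair

end Summit.QuantumFields.BalabanUV.Beta.CombSlicePairPolarization
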